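import Summits.ResolutionOfSingularities.ResolutionOfSingularities.Theorems.EquisingularLiftEquisingularLiftNatCarrierStrictTransformStalks
import Summits.ResolutionOfSingularities.ResolutionOfSingularities.Theorems.EquisingularLiftEquisingularLiftNatBlowupStalkIsoOfPrincipal
import Summits.ResolutionOfSingularities.ResolutionOfSingularities.Theorems.HilbertSamuelEliminationSigmaMaxModificationsCorridor3StrictTransformKernel
import Literature.AlgebraicGeometry.Resolution.SNCStrataSmooth
import Literature.AlgebraicGeometry.Resolution.RegularLocalRingsProofs
import Literature.AlgebraicGeometry.Resolution.MarkedIdealsArithmetic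
import Literature.AlgebraicGeometry.Resolution.CoefficientIdealRestriction
import Literature.AlgebraicGeometry.Resolution.StalkIdealLemmas
import HarnessLib

/-!
# [OURS · L1 W4.5(b) · EL♮(3)] HSUB(ReachTC⁺) — K7c REGULARITY OF THE REGULAR IN-CARRIER STEP: over the stepped point the quotient
# stalks of `St 𝓢 ⊔ St K` are those of `D = V(𝓢 ⊔ K)` (registered stub `stub_elnat_tcPlusPointResolution`; brick K7c, clause (v)
# of `TCPlus.Member` after a regular step)

Crux `EquisingularLiftNat` = stmt-ResolutionOfSingularities-20038 (child EL♮(3) = stmt-ResolutionOfSingularities-20148), route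
EquisingularLift, line `sections`. Helper file `--supports stmt-ResolutionOfSingularities-20148 --as helper` by res-L1-w45b-stub-1
(HSUB(ReachTC⁺) assembly). HONEST FRAMING: OURS (cell res-hironaka, slot W4.5(b)); NOT a statement of any manuscript; AI-written,
weaker than expert review. No `sorry`; standard axioms.

SETTING. `τ : X' → X` the blow-up of `C` (the section `ker s`), an in-carrier pair `(𝓢, K)` with an ADAPTED frame `c` at
`p ∈ V(C)` (…NatAdaptedFrame: `𝓢_p = (c₀)`, `K_p = (Φ(c′))`, `Φ mod (c) ≠ 0`, `c` quasi-regular, `𝒪/(c)` a domain, the tail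
quasi-regular mod `c₀`), the surface `D = V(𝓢 ⊔ K)` REGULAR at `p` (quotient stalk regular), and the centre PRINCIPAL ON `D` at `p`:
`C_p ⊆ (𝓢 ⊔ K)_p + (g)` with `g ∈ C_p ∖ (𝓢 ⊔ K)_p` (at a regular point the section is a Cartier divisor of the surface).

* **`isRegularLocalRing_quotient_carrierStrictTransform_of_regularPoint`** — for every `z` over `p` on `V(St 𝓢 ⊔ St K)`:
  `𝒪_{X',z} ⧸ (St 𝓢 ⊔ St K)_z` is a regular local ring of the same dimension as `𝒪_{X,p} ⧸ (𝓢 ⊔ K)_p`.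

PROOF. `(St 𝓢 ⊔ St K)_z = St(𝓢 ⊔ K)_z` (res-L1-w45b-stub-1 p522194 `stalkIdeal_strictTransformIdeal_sup_eq_sup`);
`V(St(𝓢 ⊔ K)) → D` is a blow-up of `D` along `C|_D` (W4.2 `isBlowup_subscheme_strictTransformIdeal`), whose centre is principal and
generated by a non-zero-divisor at the point `d` of `D` under `p`; so its stalk maps over `d` are isomorphisms (res-L1-w45b-stub-1
`isIso_stalkMap_of_isBlowup_of_stalkIdeal_eq_span_singleton`, p534743), and the quotient stalks are the local rings of the
subschemes (Literature `nonempty_stalkSubschemeEquiv`).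

References: [cite: GortzWedhorn2020, Prop. 13.91, Prop. 13.96 (2)]; [cite: StacksProject, Tag 080E].
-/

set_option linter.dupNamespace false -- mandated namespace `Summit.<Summit>.<Problem>` of this single-conjunct summit

noncomputable section

open CategoryTheory CategoryTheory.Limits AlgebraicGeometry TopologicalSpace Topology IsLocalRing
open Literature.AlgebraicGeometry.Resolution
open AlgebraicGeometry.Scheme.IdealSheafData
open Summit.ResolutionOfSingularities.ResolutionOfSingularities.Theorems.SigmaMaxModificationsCorridor3.Helpers

namespace Summit.ResolutionOfSingularities.ResolutionOfSingularities.Cruxes.EquisingularLiftNat.Sections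

/-- The local ring of `V(J)` at `c` as a quotient of `𝒪_{X,x}` for ANY `x = ι c` (transport along the point equality): a
surjection `φ : 𝒪_{X,x} → 𝒪_{V(J),c}` with kernel `J_x` computing the restricted stalks `(K|_{V(J)})_c = φ(K_x)`. [folklore] -/
theorem exists_stalkMap_subscheme_of_eq {X : Scheme.{0}} (J : X.IdealSheafData) (c : J.subscheme) (x : X)
    (hx : J.subschemeι c = x) :
    ∃ φ : X.presheaf.stalk x →+* J.subscheme.presheaf.stalk c, Function.Surjective φ ∧ RingHom.ker φ = stalkIdeal J x ∧
      ∀ K : X.IdealSheafData, stalkIdeal (K.comap J.subschemeι) c = (stalkIdeal K x).map φ := by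
  subst hx
  exact ⟨(J.subschemeι.stalkMap c).hom, J.subschemeι.stalkMap_surjective c, ker_stalkMap_subschemeι J c,
    fun K => stalkIdeal_comap_eq_map_stalkMap J.subschemeι K c⟩

/-- **K7c, regularity over the stepped point of a regular in-carrier step** (see the module docstring for the setting): for
every point `z` of `V(St 𝓢 ⊔ St K)` over `p`, the quotient stalk `𝒪_{X',z} ⧸ (St 𝓢 ⊔ St K)_z` is a regular local ring and
has the dimension of `𝒪_{X,p} ⧸ (𝓢 ⊔ K)_p`. [cite: GortzWedhorn2020, Prop. 13.96 (2)] [OURS · L1 W4.5b] brick K7c toward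
`stub_elnat_tcPlusPointResolution`; NOT a statement of the manuscript. -/
theorem isRegularLocalRing_quotient_carrierStrictTransform_of_regularPoint {X X' : Scheme.{0}} [IsLocallyNoetherian X]
    [IsLocallyNoetherian X'] {τ : X' ⟶ X} {C : X.IdealSheafData} (hτ : IsBlowup τ C) (𝓢 K : X.IdealSheafData)
    (p : X) (hp : p ∈ (C.support : Set X))
    -- the adapted frame at `p`
    {r : ℕ} (c : Fin (r + 1) → X.presheaf.stalk p) (hcJ : Ideal.span (Set.range c) = stalkIdeal C p)
    (hc : IsQuasiRegular c) [IsDomain (X.presheaf.stalk p ⧸ Ideal.span (Set.range c))]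
    (hcb : IsQuasiRegular fun l : Fin r => Ideal.Quotient.mk (Ideal.span {c 0}) (c l.succ))
    (h𝓢 : stalkIdeal 𝓢 p = Ideal.span {c 0}) {d : ℕ} (Φ : MvPolynomial (Fin r) (X.presheaf.stalk p))
    (hΦd : Φ.IsHomogeneous d) (hΦ : MvPolynomial.map (Ideal.Quotient.mk (Ideal.span (Set.range c))) Φ ≠ 0)
    (hK : stalkIdeal K p = Ideal.span {MvPolynomial.eval (fun l => c l.succ) Φ})
    -- `D = V(𝓢 ⊔ K)` regular at `p`, the centre principal on `D` at `p`
    (hDreg : IsRegularLocalRing (X.presheaf.stalk p ⧸ stalkIdeal (𝓢 ⊔ K) p))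
    (g : X.presheaf.stalk p) (hgC : g ∈ stalkIdeal C p) (hg0 : g ∉ stalkIdeal (𝓢 ⊔ K) p)
    (hCg : stalkIdeal C p ≤ stalkIdeal (𝓢 ⊔ K) p ⊔ Ideal.span {g})
    (z : X') (hz : τ z = p) (hzD : z ∈ ((strictTransformIdeal τ C 𝓢 ⊔ strictTransformIdeal τ C K).support : Set X')) :
    IsRegularLocalRing (X'.presheaf.stalk z ⧸ stalkIdeal (strictTransformIdeal τ C 𝓢 ⊔ strictTransformIdeal τ C K) z) ∧
      ringKrullDim (X'.presheaf.stalk z ⧸ stalkIdeal (strictTransformIdeal τ C 𝓢 ⊔ strictTransformIdeal τ C K) z) =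
        ringKrullDim (X.presheaf.stalk p ⧸ stalkIdeal (𝓢 ⊔ K) p) := by
  classical
  subst hz
  set I : X.IdealSheafData := 𝓢 ⊔ K with hIdef
  -- (1) the stalk of `St 𝓢 ⊔ St K` at `z` is that of `St (𝓢 ⊔ K)`
  have hzS : z ∈ ((strictTransformIdeal τ C 𝓢).support : Set X') := by
    have h := hzD
    rw [Scheme.IdealSheafData.support_sup] at h
    exact h.1
  have hsum : stalkIdeal (strictTransformIdeal τ C I) z =
      stalkIdeal (strictTransformIdeal τ C 𝓢 ⊔ strictTransformIdeal τ C K) z := by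
    rw [stalkIdeal_sup]
    exact stalkIdeal_strictTransformIdeal_sup_eq_sup hτ 𝓢 K z hp c hcJ hc hcb h𝓢 Φ hΦd hΦ hK hzS
  -- (2) the strict transform `V(Q) → D`, a blow-up of `D = V(I)` along `C|_D`
  obtain ⟨ρ, hρ⟩ := exists_hom_subscheme_strictTransformIdeal τ C I.subschemeι
  have hbl : IsBlowup ρ (C.comap I.subschemeι) := isBlowup_subscheme_strictTransformIdeal hτ I.subschemeι ρ hρ
  have hQI : strictTransformIdeal τ C I.subschemeι.ker = strictTransformIdeal τ C I := by
    rw [Scheme.IdealSheafData.ker_subschemeι]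
  -- the point `z̃` of `V(Q)` over `z`
  have hzQ : z ∈ ((strictTransformIdeal τ C I.subschemeι.ker).support : Set X') := by
    rw [hQI]
    refine (mem_support_iff_stalkIdeal_le _ _).mpr ?_
    rw [hsum]
    exact (mem_support_iff_stalkIdeal_le _ _).mp hzD
  obtain ⟨zt, hzt⟩ : z ∈ Set.range (strictTransformIdeal τ C I.subschemeι.ker).subschemeι := by
    rw [Scheme.IdealSheafData.range_subschemeι]; exact hzQ
  subst hzt
  -- the point `d := ρ z̃` of `D` lies under `p = τ z`
  have hd : I.subschemeι (ρ zt) = τ ((strictTransformIdeal τ C I.subschemeι.ker).subschemeι zt) := by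
    rw [← Scheme.Hom.comp_apply, hρ, Scheme.Hom.comp_apply]
  -- (3) `𝒪_{D,d}` as the quotient of `𝒪_{X,p}` by `I_p`; the centre `C|_D` is `(φ g)` at `d`, `φ g` a non-zero-divisor
  obtain ⟨φ, hφsurj, hφker, hφcomap⟩ := exists_stalkMap_subscheme_of_eq I (ρ zt) _ hd
  let eD : (X.presheaf.stalk (τ ((strictTransformIdeal τ C I.subschemeι.ker).subschemeι zt)) ⧸ stalkIdeal I _) ≃+*
      I.subscheme.presheaf.stalk (ρ zt) :=
    (Ideal.quotEquivOfEq hφker.symm).trans (RingHom.quotientKerEquivOfSurjective hφsurj)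
  haveI : IsRegularLocalRing (I.subscheme.presheaf.stalk (ρ zt)) := IsRegularLocalRing.of_ringEquiv eD
  haveI : IsDomain (I.subscheme.presheaf.stalk (ρ zt)) := isDomain_of_isRegularLocalRing _
  have hg'0 : φ g ≠ 0 := by
    intro h0
    apply hg0
    rw [← hφker, RingHom.mem_ker]
    exact h0
  have hJd : stalkIdeal (C.comap I.subschemeι) (ρ zt) = Ideal.span {φ g} := by
    rw [hφcomap]
    apply le_antisymm
    · refine (Ideal.map_mono hCg).trans ?_
      rw [Ideal.map_sup, Ideal.map_span, Set.image_singleton]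
      have h0 : Ideal.map φ (stalkIdeal I (τ ((strictTransformIdeal τ C I.subschemeι.ker).subschemeι zt))) = ⊥ := by
        rw [← hφker, Ideal.map_eq_bot_iff_le_ker]
      rw [h0, bot_sup_eq]
    · rw [Ideal.span_singleton_le_iff_mem]
      exact Ideal.mem_map_of_mem _ hgC
  -- (4) the stalk map of `ρ` at `z̃` is an isomorphism
  haveI hiso : IsIso (ρ.stalkMap zt) :=
    isIso_stalkMap_of_isBlowup_of_stalkIdeal_eq_span_singleton hbl (mem_nonZeroDivisors_of_ne_zero hg'0) hJd rfl
  let e₁ : I.subscheme.presheaf.stalk (ρ zt) ≃+* (strictTransformIdeal τ C I.subschemeι.ker).subscheme.presheaf.stalk zt :=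
    (asIso (ρ.stalkMap zt)).commRingCatIsoToRingEquiv
  obtain ⟨eQ⟩ := nonempty_stalkSubschemeEquiv (strictTransformIdeal τ C I.subschemeι.ker) zt
  -- the quotient stalk at `z`, through `Q_z = (St 𝓢 ⊔ St K)_z`
  have hQz : stalkIdeal (strictTransformIdeal τ C I.subschemeι.ker) ((strictTransformIdeal τ C I.subschemeι.ker).subschemeι zt) =
      stalkIdeal (strictTransformIdeal τ C 𝓢 ⊔ strictTransformIdeal τ C K)
        ((strictTransformIdeal τ C I.subschemeι.ker).subschemeι zt) := by
    have h : ∀ x' : X', stalkIdeal (strictTransformIdeal τ C I.subschemeι.ker) x' = stalkIdeal (strictTransformIdeal τ C I) x' :=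
      fun x' => by rw [hQI]
    rw [h]; exact hsum
  let e : (X'.presheaf.stalk ((strictTransformIdeal τ C I.subschemeι.ker).subschemeι zt) ⧸
      stalkIdeal (strictTransformIdeal τ C 𝓢 ⊔ strictTransformIdeal τ C K)
        ((strictTransformIdeal τ C I.subschemeι.ker).subschemeι zt)) ≃+*
      (X.presheaf.stalk (τ ((strictTransformIdeal τ C I.subschemeι.ker).subschemeι zt)) ⧸ stalkIdeal I _) :=
    ((Ideal.quotEquivOfEq hQz.symm).trans eQ).trans (e₁.symm.trans eD.symm)
  exact ⟨IsRegularLocalRing.of_ringEquiv e.symm, ringKrullDim_eq_of_ringEquiv e⟩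

end Summit.ResolutionOfSingularities.ResolutionOfSingularities.Cruxes.EquisingularLiftNat.Sections

end
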